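import Literature.NumberTheory.EllipticCurves.Kobayashi2003.SignedSelmerEtaComponentFacts
import Literature.NumberTheory.EllipticCurves.Rank1Residual.Predicates
import Literature.NumberTheory.EllipticCurves.QuadraticTwist
import Literature.NumberTheory.EllipticCurves.IwasawaAlgebra
import HarnessLib

/-!
# Fouquet–Wan (arXiv:2107.13726, PREPRINT), Thm. 5.1 / Prop. 5.6 for the ADDITIVE TWIST `f_W = f_V ⊗ η`
# of a good supersingular `a_p = 0` curve `V` by `η = ω^{(p−1)/2}`: the CLAIMED Kato main conjecture,
# read at the `η`-COMPONENT of `T_pV` in the currency of Kobayashi's proof of Thm. 7.4 — ONE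
# explicitly labelled OPEN binder (claim-tagged; NEVER a fact)

HONEST FRAMING (cell `bsd-potss`, `run/shared/lean/pub/bsd-potss/`, FULL-BSD rank `≤ 1` programme,
rows B4/B5 = additive potentially supersingular primes; route K8 `QuadraticBranchSignedControl`, child
crux `PlusEtaLowerInclusion` = item stmt-BirchSwinnertonDyer-19601, registered stub
`stub_etaLower_fwLocus`; seat `bsd-potss-k8-fw`): an UNREFEREED preprint enters the tree ONLY as an
explicitly labelled OPEN hypothesis, NEVER as a theorem and NEVER as a named fact; nothing here is
asserted about any curve; nothing is booked; no `_holds`. The pattern is that of the sibling file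
`FouquetWan2021/KatoMainConjecturePPartOPEN.lean` (`cor54_pPart_rankZero_OPEN`: the SAME claim, Thm.
5.1, read through its Cor. 5.4 at a GOOD supersingular prime); THIS file reads the claim for the
newform `f_W` of the ADDITIVE quadratic twist `W = V ⊗ η` (`η = ω^{(p−1)/2}` the quadratic character of
`Δ = Gal(ℚ(μ_p)/ℚ)`, `V` good at `p` with `a_p(V) = 0`, `W` of Kodaira type `I₀*` at `p`) — the level
`Np^r` of Thm. 5.1 allows it (`N_W = N_V·p²`), and FW's Prop. 5.6 names exactly these points
("crystalline and short up to the quadratic twist `ω^{(p−1)/2}`") — and records its consequence at the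
`η`-COMPONENT of Kato's main conjecture for `T_pV` over `ℚ(μ_{p^∞})`, in the only currency the tree has
for Kato's modules `𝐇¹(T)^η/Z(T)^η`, `𝐇²(T)^η`: their printed role in the exact sequence of the proof
of Kobayashi's Thm. 7.4 (Invent. Math. 152 (2003), p. 13), exactly as the tree's NAMED fact
`Kobayashi2003.thm74proof_etaExactSequences` (sibling directory, §5) transcribes them. So that the K8
stub `stub_etaLower_fwLocus` — the Eisenstein inclusion `Char(X⁺(V/K_∞)^η) ⊆ (L_p⁺(V, η, X))` on the
Fouquet–Wan sub-locus of the tower-onto Gss2 twists — is CONDITIONAL ON THIS ONE BINDER and nothing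
else unpublished (Theorems-side consumer:
`Summits/BirchSwinnertonDyer/BirchSwinnertonDyer/Theorems/QuadraticBranchSignedControlPlusEtaLowerInclusionFouquetWanLocus.lean`,
where the projection to the even side is KERNEL-CHECKED module theory).

## Sources, verbatim (held texts; page = chunk number)

O. Fouquet, X. Wan, *The Iwasawa Main Conjecture for universal families of modular motives*,
arXiv:2107.13726 (2021) [FouquetWan2021] (held `paper:arxiv-2107.13726`; arXiv only, no journal
version known to the tree 2026-08-26). p0002: "Let `p > 2` be a prime. Let `ℚ_∞/ℚ` be the cyclotomic
`ℤ_p`-extension of `ℚ`, let `Γ_Iw` be `Gal(ℚ_∞/ℚ)` and let `Λ_Iw := ℤ_p[[Γ_Iw]]`." p0004, **Conjecture 1.5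
([KatoEuler] Conjecture 12.10)** (= (ConjIMC)): "Let `z(f)_Iw ∈ Δ(M(f))_Iw ⊗_{Λ_Iw} Frac(Λ_Iw)` be the
basis of theorem 1.4 [= Kato, Thm. 12.4/12.5]. Then `z(f)_Iw` is a basis of `Δ(M(f))_Iw`. Equivalently,
there is an equality of characteristic ideals
`char_{Λ_Iw} H²_et(ℤ[1/p], T ⊗ Λ_Iw) = char_{Λ_Iw} H¹_et(ℤ[1/p], T ⊗ Λ_Iw)/Λ_Iw·z(f)_Iw`." p0053,
**Theorem 5.1.** "Let `p ≥ 3` be a prime. Let `f ∈ S_k(Γ₀(Np^r))` be a normalized eigencuspform with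
`k ≥ 2`. Assume that `ρ̄_f` satisfies the following properties. • The `G_{ℚ,Σ}`-representation `ρ̄_f` is
absolutely irreducible. • The semisimplification of `ρ̄_f|G_{ℚ_p}` is not equal to `χ̄ ⊕ χ̄_cyc χ̄`.
• There exists `ℓ ∤ p` such that `ρ̄_f|G_{ℚ_ℓ}` is a ramified extension
`0 → μχ_cyc^{1−k/2} → ρ̄|G_{ℚ_ℓ} → μχ_cyc^{−k/2} → 0` where `μ : G_{ℚ_ℓ} → {±1}` is an unramified
character. If moreover `ρ̄_f|G_{ℚ_p}` is irreducible, then `μ` is not trivial. If `ℓ ∥ N`, then the zeta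
morphism is an isomorphism `triv_{z(f)_Iw} : Δ_{O_Iw}(T(f)_Iw) ≅ O_Iw`. Equivalently, conjecture
(ConjIMC) is true." p0054, **Proposition 5.6.** "Suppose that `ψ(f) : 𝕋^Σ_{𝔪_ρ̄} → O` is a classical
point which is either crystalline and short, or crystalline and short up to the quadratic twist
`ω^{(p−1)/2}` (recall `ω` is the Teichmuller character), or good ordinary, or good ordinary up to a
quadratic twist. Then […] conjecture (ConjIMC) is true for `ψ(f)`. *Proof.* […] The cases involving
quadratic twists are proved in the completely same way."

S. Kobayashi, Invent. Math. 152 (2003) 1–36 [Kobayashi2003] (held `paper:doi-10-1007-s00222-002-0265-4`).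
p. 10 (§5): "In [6], Kato formulated the Iwasawa main conjecture for motives. As a special case, his
main conjecture can be read as follows (cf. Conjecture 12.10 in [7]). **Conjecture (Kato's main
conjecture).** Let `η : Δ → ℤ_p^×` be a character. Then, `Z(T)^η ⊆ 𝐇¹(T)^η` and
`Char 𝐇²(T)^η = Char 𝐇¹(T)^η/Z(T)^η`." (`𝐇^q(T) = lim_n H^q(Spec O_{K_n}[1/p], j_*T)`, `K_n = ℚ(ζ_{p^{n+1}})`,
p. 8.) p. 13, proof of **Thm. 7.4**: "By Theorem 6.2, 6.3 and (7.21), we have three exact sequences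
`0 → 𝐇¹(T)^η/Z(T)^η → Λ^η/(L_p⁺(E, η, X)) → X⁺(E/K_∞)^η → X⁰(E/K_∞)^η → 0`, […] The theorem follows
from these sequences and Proposition 7.1 ii)" (Prop. 7.1 ii), p. 12: "`𝐇²(T)` is isomorphic to
`X⁰(E/K_∞)` as `Λ`-module"; Cor. 7.2: "`X⁰(E/K_∞)` is a torsion `Λ`-module").

## Transcription (the dictionary, for the referee) and the ONE reading flag

FW for `f = f_W`, `W/ℚ` globally minimal, `V` a globally minimal model of the quadratic twist of `W`
by `p* = (−1)^{⌊p/2⌋} p` (`C • W.quadraticTwist p* = V`) with GOOD reduction at `p` and `a_p(V) = 0`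
(so `ρ_W ≅ ρ_V ⊗ η`, `η` the quadratic character of `ℚ(√p*) ⊂ ℚ(μ_p)`; `f_W = f_V ⊗ η` has level
`N_V p²`, trivial character, weight `k = 2`, allowed by `Γ₀(Np^r)`; it is FW's "crystalline and short
up to the quadratic twist `ω^{(p−1)/2}`" point of Prop. 5.6): bullet 1 = `Irr W p` (`W[p]` irreducible
and odd, `p` odd; DISPLAYED — printed — though automatic, `W[p] ≅ V[p] ⊗ η` with `V[p]` irreducible at
a supersingular `p`, Serre 1972 Prop. 12); bullet 2 and the clause "`μ` not trivial" follow from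
`ρ̄_W|G_{ℚ_p} ≅ ρ̄_V|G_{ℚ_p} ⊗ η` IRREDUCIBLE (`V` good supersingular at `p`: fundamental characters of
level `2`) — encoded by the displayed binders "good at `p`, `a_p(V) = 0`, twin relation", as in the
sibling file; bullet 3 with `ℓ ∥ N` for `k = 2` = a prime `ℓ ≠ p` of NON-SPLIT multiplicative reduction
of `W` at which `W[p]` is RAMIFIED, i.e. `p ∤ ord_ℓ(Δ_min(W))` (Tate) — the sibling file's `ℓ`-datum
verbatim (= the Summits-side census predicate `FWNonsplitRam W p`). CONCLUSION, read at `η` for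
`T = T_pV`: Kato's main conjecture at the component `η` (Kobayashi §5 display), stated on modules
`A` («`𝐇¹(T_pV)^η/Z(T_pV)^η`») and `B` («`𝐇²(T_pV)^η ≅ X⁰(V/K_∞)^η`», finitely generated torsion) PINNED
by Kobayashi's plus `η`-sequence `0 → A → Λ/(Lp) → X⁺(V/K_∞)^η → B → 0` for SOME `Lp` with the
interpolation property (3.4)+(3.6) of `L_p⁺(V, η, X)` and EVERY Pontryagin-dual datum of
`Sel⁺(V/K_∞)^η` (binder for binder the plus half of `Kobayashi2003.thm74proof_etaExactSequences`, a
PUBLISHED theorem), as the equality **`char_Λ(A) = char_Λ(B)`** — THE CLAIM.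
* READING FLAG `FW21-eta-twist-transfer`. FW's (ConjIMC) for `M(f_W)` is Kato's Conj. 12.10 for
  `(f_W, p)` over `Λ_Iw = ℤ_p[[Gal(ℚ_∞/ℚ)]]`, i.e. on the `Δ`-TRIVIAL component for `T_pW`; the binder
  states Kato's Conj. 12.10 for `(f_V, p)` at the component `η` (Kato's conjecture is formulated for
  every component; Kobayashi §5). The two have the same Galois-cohomology modules (`T_pW ≅ T_pV ⊗ η`,
  `η` trivial on `Gal(ℚ̄/ℚ(μ_p))`, Shapiro: `H^q(ℤ[1/p], T_pW ⊗ Λ_Iw) ≅ 𝐇^q(T_pV)^η`) and zeta submodules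
  characterised by the same values `L_{(p)}(f_W, χ, 1) = L_{(p)}(f_V, ηχ, 1)` (Kato Thm. 12.5 (1));
  the identification of Kato's zeta submodule of `f_W` with the `η`-part of that of `f_V` under this
  isomorphism (twisting an Euler system by a character of finite order of `Gal(ℚ(μ_{p^∞})/ℚ)`, Rubin,
  *Euler Systems*, Ch. II §4 and Ch. VI) is NOT written in [FouquetWan2021] nor in Kato's Astérisque
  volume for this pair of forms; it is the same step as (B2b) of the Summits-side bridge
  `Additive.QuadraticBranchKatoBridge` (there: "NOT verbatim in print"). This flag is part of WHY the
  binder is OPEN; it is not hidden in a proof.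
* Flags inherited from the Kobayashi transcription: `Kob03-Thm74-eta-by-eta`,
  `Kob03-721-eta-abstract-ends`, `Kob03-Lpm-eta-upto-unit` (see `SignedSelmerEtaComponentFacts.lean`).
* AUDIT POINTER (why PRE): as in the sibling file — at a non-ordinary `p` FW's Eisenstein side rests
  on Wan's withdrawn 2015 preprint (arXiv:1411.6352; Burungale–Skinner–Tian–Wan 2024 Rem. 1.4 (i)),
  and the local computation at an ADDITIVE potentially good prime of the twisted form is not written
  in the sources FW cite. FRESHNESS 2026-08-26: arXiv only.
-- TODO(general form): FW's Thm. 5.1 is for any `f ∈ S_k(Γ₀(Np^r))`, `k ≥ 2`, any reduction at `p`,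
-- and Kato's Conj. 12.10 for every component of `ℤ_p[[Gal(ℚ(ζ_{p^∞})/ℚ)]]`; only the weight-2,
-- `η = ω^{(p−1)/2}`, `a_p(V) = 0` reading consumed by the K8 stub is typed (no `𝐇^q(T)`/`Z(T)`
-- vocabulary in the tree beyond Kobayashi's exact sequence).

WHAT IS NOT HERE: no theorem, no `_holds`, no assertion for any curve; no minus-sign sequence (the
odd side is not consumed); nothing at `p = 2`; no claim that the flag's identification holds; the
Summits-side node (E⁺_η) `Additive.QuadraticBranchPlusEtaLowerInclusionAt` is NOT restated here (the
conclusion is in Kato's currency, the projection to Kobayashi's even side is proved Summits-side).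

## References
* [FouquetWan2021] arXiv:2107.13726: §1.1.1 (p. 2, `Λ_Iw`), Conj. 1.5 (p. 4), Thm. 5.1 (p. 53), Prop. 5.6 (p. 54).
* [Kato2004Asterisque] K. Kato, Astérisque 295 (2004): Thm. 12.4, Thm. 12.5 (1) (p. 222), Conj. 12.10 (p. 224).
* [Kobayashi2003] §5 (p. 10), Thm. 6.2, Thm. 6.3 (p. 11), Prop. 7.1 ii) (p. 12), Cor. 7.2, (7.21), Thm. 7.4 (p. 13), Thm. 3.2, (3.4), (3.6) (p. 7).
* [Rubin2000] K. Rubin, *Euler Systems*, Ann. of Math. Stud. 147, Ch. II §4, Ch. VI (twisting by characters of finite order).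
* [Serre1972] §1.11 Prop. 12 (`E[p]|G_{ℚ_p}` at a supersingular prime).
-/

noncomputable section

open scoped Classical

open CongruenceSubgroup WeierstrassCurve Field Literature.NumberTheory.EllipticCurves
  Literature.NumberTheory.EllipticCurves.ModularForms Literature.NumberTheory.GaloisRepresentations
  Literature.NumberTheory.EllipticCurves.Rank1Residual ZpExtension

namespace Literature.NumberTheory.EllipticCurves.FouquetWan2021

/-- **UNREFEREED-PREPRINT HYPOTHESIS (PRE binder) (Fouquet–Wan, arXiv:2107.13726, 2021), Thm. 5.1 / Prop. 5.6
for the newform of the ADDITIVE quadratic twist `W = V ⊗ η`, read at the `η`-component of Kato's main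
[C] for `T_pV` in the currency of Kobayashi's proof of Thm. 7.4.** "Let `p ≥ 3` be a prime. Let
`f ∈ S_k(Γ₀(Np^r))` be a normalized eigencuspform with `k ≥ 2`. Assume that […] `ρ̄_f` is absolutely
irreducible [;] the semisimplification of `ρ̄_f|G_{ℚ_p}` is not equal to `χ̄ ⊕ χ̄_cyc χ̄` [; there is]
`ℓ ∤ p` such that `ρ̄_f|G_{ℚ_ℓ}` is a ramified extension `0 → μχ_cyc^{1−k/2} → ρ̄|G_{ℚ_ℓ} → μχ_cyc^{−k/2} → 0`
[`μ` unramified quadratic, non-trivial if `ρ̄_f|G_{ℚ_p}` is irreducible]. If `ℓ ∥ N`, then […]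
(ConjIMC) [`char_{Λ_Iw} H²_et(ℤ[1/p], T ⊗ Λ_Iw) = char_{Λ_Iw} H¹_et(ℤ[1/p], T ⊗ Λ_Iw)/Λ_Iw·z(f)_Iw`,
= Kato, Astérisque 295, 12.10] is true." Transcribed for `f = f_W`: `p` an odd prime, `W/ℚ` globally minimal,
`V` a globally minimal model of `W^{(p*)}`, `p* = (−1)^{⌊p/2⌋} p` (`C • W.quadraticTwist p* = V`), `V`
GOOD at `p` with `a_p(V) = 0` (so `ρ̄_W|G_{ℚ_p} = ρ̄_V|G_{ℚ_p} ⊗ η` is irreducible: bullet 2 holds and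
`μ` must be non-trivial), `W[p]` irreducible (`Irr W p`, bullet 1, printed), and a prime `ℓ ≠ p` of
NON-SPLIT multiplicative reduction of `W` with `p ∤ ord_ℓ(Δ_min(W))` (bullet 3 with `ℓ ∥ N_W`); for
`K₀ = ℚ(μ_p)`, `η` THE quadratic character of `Gal(K₀/ℚ)` (trivial on `Gal(ℚ̄/K₀)`, `≠ 1`), the
newform `f` of `V`, the period ratio `ϖ` of the parity of `η`, the cyclotomic `ℤ_p`-extension `κ` and
a topological generator `γ ∈ Gal(ℚ̄/K₀)` matching the variable (`γ ↦ 1 + X`): THERE ARE `Λ`-modules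
`A` («`𝐇¹(T_pV)^η/Z(T_pV)^η`») and `B` («`𝐇²(T_pV)^η ≅ X⁰(V/K_∞)^η`», finitely generated torsion —
Kobayashi Cor. 7.2 / Prop. 7.1 ii)) and SOME `Lp` with the interpolation property of `L_p⁺(V, η, X)`
such that every Pontryagin-dual datum `D` of `Sel⁺(V/K_∞)^η` sits in an exact sequence
`0 → A → Λ/(Lp) → D.X → B → 0` (Kobayashi (7.21) + Thm. 6.2 + Thm. 6.3 at `η`, p. 13 — PUBLISHED, the
plus half of `Kobayashi2003.thm74proof_etaExactSequences`), AND **`char_Λ(A) = char_Λ(B)`** — Kato's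
main [C] at the component `η` ("`Char 𝐇²(T)^η = Char 𝐇¹(T)^η/Z(T)^η`", Kobayashi §5 p. 10),
which is THE CLAIM: its only source on this locus is FW's (ConjIMC) for `M(f_W)` over `Λ_Iw =
ℤ_p[[Gal(ℚ_∞/ℚ)]]` transported to the `η`-component of `T_pV` (READING FLAG `FW21-eta-twist-transfer`,
module docstring: same cohomology modules, zeta submodules identified by a finite-order twist — not
written in the sources). NEVER cite this `Prop` as a theorem; take it as an explicit hypothesis.
[claim: FouquetWan2021, status: under-review] -/
def thm51_etaKatoMC_OPEN : Prop :=
  ∀ (p : ℕ) [Fact p.Prime] (K₀ : Type) [Field K₀] [NumberField K₀] [IsCyclotomicExtension {p} ℚ K₀]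
    [(galRange (K := ℚ) K₀).Normal] (η : absoluteGaloisGroup ℚ →* ℤˣ),
    (∀ σ ∈ galRange (K := ℚ) K₀, η σ = 1) → η ≠ 1 →
  ∀ (V : WeierstrassCurve ℚ) [V.IsElliptic] [V.IsGloballyMinimal]
    (W : WeierstrassCurve ℚ) [W.IsElliptic] [W.IsGloballyMinimal] (C : VariableChange ℚ),
    p ≠ 2 → C • W.quadraticTwist ((-1) ^ (p / 2) * p) = V →
    V.HasGoodReductionAtPrime p → V.frobeniusTrace p = 0 → Irr W p →
    (∃ (ℓ : ℕ) (_ : Fact ℓ.Prime), ℓ ≠ p ∧ W.HasMultiplicativeReductionAtPrime ℓ ∧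
        ¬ W.HasSplitMultiplicativeReductionAtPrime ℓ ∧ ¬ p ∣ padicValInt ℓ W.minimalDiscriminantInt) →
  ∀ {N : ℕ} [NeZero N] {f : CuspForm (Gamma0 N) 2}, IsNewformOf V f →
  ∀ (ϖ : ℚ), (if Even (p / 2) then (ϖ : ℝ) * V.realPeriodRat = plusPeriod f
      else (ϖ : ℝ) * V.imaginaryPeriodRat = minusPeriod f) →
  ∀ (κ : ZpExtension ℚ p) (γ : absoluteGaloisGroup ℚ),
    κ.IsCyclotomic → κ.IsTopGenerator γ → γ ∈ galRange (K := ℚ) K₀ → IsCyclotomicVariable p γ →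
  ∃ (A B : Type) (_ : AddCommGroup A) (_ : Module (IwasawaAlgebra p) A)
    (_ : AddCommGroup B) (_ : Module (IwasawaAlgebra p) B),
    Module.Finite (IwasawaAlgebra p) B ∧ Module.IsTorsion (IwasawaAlgebra p) B ∧
    (∃ Lp : IwasawaAlgebra p, Kobayashi2003.IsQuadraticBranchPlusLFunction f p ϖ Lp ∧
      ∀ D : Kobayashi2003.EtaSignedSelmerDualData V κ K₀ ℚ_[p] η γ 1,
        ∃ (i : A →ₗ[IwasawaAlgebra p] (IwasawaAlgebra p ⧸ Ideal.span {Lp}))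
          (j : (IwasawaAlgebra p ⧸ Ideal.span {Lp}) →ₗ[IwasawaAlgebra p] D.X)
          (k : D.X →ₗ[IwasawaAlgebra p] B),
          Function.Injective i ∧ Function.Exact i j ∧ Function.Exact j k ∧ Function.Surjective k) ∧
    Module.charIdeal (IwasawaAlgebra p) A = Module.charIdeal (IwasawaAlgebra p) B

end Literature.NumberTheory.EllipticCurves.FouquetWan2021

end
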